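import Literature.Barriers.RiemannHypothesis.PolyaFrequencySmoothing
import Summits.RiemannHypothesis.RiemannHypothesis.Theorems.UniversalFactorConeReduction
import Summits.RiemannHypothesis.RiemannHypothesis.Theorems.UniversalFactorLaplaceLoopholeRefutation
import HarnessLib

/-!
# Discharge of the catalogued barrier `PolyaFrequencySmoothing` (dbn / universal-factor family)

The barrier entry `Literature.Barriers.RiemannHypothesis.PolyaFrequencySmoothing` («no Pólya-frequency
smoothing `Λ ∗ H_0` of de Bruijn's `H_0` at a fixed finite even scale is real-rooted») is recorded in
`Literature/` as a NAMED FACT together with the reduction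
`Literature.Barriers.RiemannHypothesis.PolyaFrequencySmoothing_of_universalFactorNewman`, whose hypothesis is
literally the right-hand side of the summit-side equivalence
`Summit.RiemannHypothesis.RiemannHypothesis.Theorems.UniversalFactor.not_laplaceLoophole_iff_universalFactorNewman`
(`Theorems/UniversalFactorConeReduction.lean`); its left-hand side `¬ LaplaceLoophole` is the kernel-checked
refutation `Summit.RiemannHypothesis.RiemannHypothesis.Theorems.UniversalFactorLaplaceLoophole_refuted`
(`Theorems/UniversalFactorLaplaceLoopholeRefutation.lean`).  `Literature/` cannot import `Summits.*`, so the
barrier file itself says (its §«Reduction of the barrier…» docstring): «summit-side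
`PolyaFrequencySmoothing_holds := PolyaFrequencySmoothing_of_universalFactorNewman (iff.mp refuted)`» — this file
is exactly that one-line discharge, nothing else.

AXIOMS (declared): the closure of `PolyaFrequencySmoothing_holds` is `propext`, `Classical.choice`, `Quot.sound`
PLUS the tree's COMPILED one-point Laguerre certificates of the medium window `π/8 ≤ a ≤ 32`
(`…Theorems.UniversalFactor.hiWin1_check`, `hiWin2_check`, `osaWindowA_check`, `osaWindowB_check`,
`osaWindowC_check`, `osaWindowD_check`, `osaWindowH_check` — `native_decide`, inherited through
`UniversalFactor.OneSidedAverageSignTest.MediumKernelNoGo_proof` inside `UniversalFactorLaplaceLoophole_refuted`);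
no `native_decide` is run in THIS file.  Hence filed `--computational`, like every tree consumer of that refutation.
The Gaussian ray of the barrier (`S = ∅`) stays standard-axiom in the barrier file itself
(`not_hasOnlyRealZeros_pfSmoothing_gaussian`, from `rodgers_tao_holds`).

Cell rh-split (brief sha16 f79c5f09d8bcb036), seat rh-split-typer-2 g5, own initiative in idle time (dbn family:
the barrier's `blocks:` list names `DeBruijnRoute` and route `UniversalFactor`).  HONEST LABEL: a barrier
bookkeeping discharge; it certifies nothing about RH; nothing here bears on the truth of RH.
-/

noncomputable section

set_option linter.dupNamespace false

namespace Summit.RiemannHypothesis.RiemannHypothesis.Theorems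

/-- **The barrier `PolyaFrequencySmoothing` holds**: for every even Pólya frequency function `Λ` whose reciprocal
bilateral Laplace transform `Ψ` on a strip about `0` has finite even Schoenberg form, the smoothing
`z ↦ ∫ Λ(y) H_0(z − y) dy` has a non-real zero.  One line: the barrier file's reduction
`PolyaFrequencySmoothing_of_universalFactorNewman` applied to generalised Newman on the finite universal-factor
cone, i.e. to `not_laplaceLoophole_iff_universalFactorNewman.mp UniversalFactorLaplaceLoophole_refuted`.
(Computational closure inherited from the medium-window certificates; see the module docstring.) [folklore] -/
theorem PolyaFrequencySmoothing_holds :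
    Literature.Barriers.RiemannHypothesis.PolyaFrequencySmoothing :=
  Literature.Barriers.RiemannHypothesis.PolyaFrequencySmoothing_of_universalFactorNewman
    (UniversalFactor.not_laplaceLoophole_iff_universalFactorNewman.mp UniversalFactorLaplaceLoophole_refuted)

end Summit.RiemannHypothesis.RiemannHypothesis.Theorems

end
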